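import Summits.AtomisticToContinuum.FouriersLaw.Theorems.HonestZwanzigPositiveMemoryKronecker
import Summits.AtomisticToContinuum.FouriersLaw.Theorems.HonestZwanzigPositiveMemoryCutCount
import Summits.AtomisticToContinuum.FouriersLaw.Theorems.HonestZwanzigPositiveMemoryCutExpansion

/-!
# HonestZwanzig / PositiveMemory — the locality reduction (line `Sketch`, skeleton v5)

Support file for item `stmt-AtomisticToContinuum-12694` (`PositiveMemory` of route `HonestZwanzig`, sub-problem
`FouriersLaw`). Skeleton v5 of line `Sketch` derives the apex sub-extensivity input of the landed reductions
(`stub_robinReduction`, `stub_tentReduction`: `schur_s(J_ξ,J_ξ) ≤ schur_s(J,J) + εN + C_A(ε)` for the tent current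
`J_ξ`) from a ONE-SIDED MEMORY-LOCALITY hypothesis — an `N`-uniform nonnegative summable majorant `K(|b − b'|)` of the
negative part of the bond memory kernel `𝔎_N(s)_{bb'} = schur_s(j_b, j_{b'})` of the orthogonal dynamics at small `s`
(the one-sided half of the `UniformLocality` layer foreseen under crux #2 `OrthogonalOhm`). The proof is elementary
given the three landed pieces: the bilinear cut expansion (`stub_cutExpansion`), the cut-counting bound for the tent
gradient (`stub_cutCount`: `Σ_{b,b'}(1 − g_b g_{b'})K(|b−b'|) ≤ 4Σ_{z<N} zK(z) + 16Σ_{z<N} K(z)`) and Kronecker's lemma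
(`stub_kronecker`: `Σ_{z<n} zK(z) ≤ εn + C(ε)`): `fixedN_apexBound` (fixed `N`, `s`) and the registered stub
`stub_localityReduction : FeshbachIdentities → (memory locality) → (apex sub-extensivity)`. With it the primary
skeleton reads `PositiveMemory ⇐ OrthogonalOhm ∧ RobinCoercivity ∧ (one-sided memory locality)`.
-/

noncomputable section

open MeasureTheory Finset Real Set Filter Topology
open Literature.MathematicalPhysics.KineticTheory.HeatConduction
open Summit.AtomisticToContinuum.FouriersLaw.Theorems.HonestZwanzig.NetworkReduction
open Summit.AtomisticToContinuum.FouriersLaw.Theorems.RobinCoercivity.Negative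

namespace Summit.AtomisticToContinuum.FouriersLaw.Theorems.HonestZwanzig.PositiveMemory

section Package

variable {ω₂ lam β γ : ℝ} {N : ℕ} {T : ℝ}
  {Adm : (PhaseSpace N → ℝ) → Prop}
  {corr : (PhaseSpace N → ℝ) → (PhaseSpace N → ℝ) → ℝ → ℝ}
  {lap : ℝ → (PhaseSpace N → ℝ) → (PhaseSpace N → ℝ) → ℝ}
  {cov : (PhaseSpace N → ℝ) → (PhaseSpace N → ℝ) → ℝ}
  {e : Fin N → PhaseSpace N → ℝ}
  (hAdm : ∀ f, Adm f ↔ (Continuous f ∧ ∃ A : ℝ, ∀ z,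
    |f z| ≤ A * Real.exp ((pinnedChain ω₂ lam β γ).hamiltonian N z / (8 * T))))
  (hcorr : ∀ f g t, corr f g t =
    (∫ z, f z * (∫ y, g y ∂((pinnedChain ω₂ lam β γ).transitionKernel N T T t.toNNReal z))
      ∂(pinnedChain ω₂ lam β γ).gibbsMeasure N T) -
    (∫ z, f z ∂(pinnedChain ω₂ lam β γ).gibbsMeasure N T) *
      (∫ z, g z ∂(pinnedChain ω₂ lam β γ).gibbsMeasure N T))
  (hlap : ∀ s f g, lap s f g = ∫ t in Set.Ioi (0 : ℝ), Real.exp (-(s * t)) * corr f g t)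
  (hcov : ∀ f g, cov f g = (∫ z, f z * g z ∂(pinnedChain ω₂ lam β γ).gibbsMeasure N T) -
    (∫ z, f z ∂(pinnedChain ω₂ lam β γ).gibbsMeasure N T) *
      (∫ z, g z ∂(pinnedChain ω₂ lam β γ).gibbsMeasure N T))
  (he : ∀ x z, e x z = z.2 x ^ 2 / 2 + (pinnedChain ω₂ lam β γ).U (z.1 x) +
    ∑ j : Fin N, ((if j.val = x.val + 1 then (pinnedChain ω₂ lam β γ).V (z.1 j - z.1 x) / 2 else 0) +
      (if x.val = j.val + 1 then (pinnedChain ω₂ lam β γ).V (z.1 x - z.1 j) / 2 else 0)))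
  (hFI : ∀ f g : PhaseSpace N → ℝ, Adm f → Adm g →
    Integrable f ((pinnedChain ω₂ lam β γ).gibbsMeasure N T) ∧
    (∀ t : ℝ, 0 ≤ t → Integrable (fun z => f z *
      (∫ y, g y ∂((pinnedChain ω₂ lam β γ).transitionKernel N T T t.toNNReal z)))
      ((pinnedChain ω₂ lam β γ).gibbsMeasure N T)) ∧
    IntegrableOn (corr f g) (Set.Ioi 0) ∧
    (∀ t : ℝ, 0 ≤ t → corr f g t = corr (fun z => g (z.1, -z.2)) (fun z => f (z.1, -z.2)) t) ∧
    (∀ s : ℝ, 0 < s → ∀ x : Fin N,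
      s * lap s (e x) g - cov (e x) g =
        lap s (fun z => (pinnedChain ω₂ lam β γ).generator N T T (e x) (z.1, -z.2)) g ∧
      s * lap s f (e x) - cov f (e x) = lap s f ((pinnedChain ω₂ lam β γ).generator N T T (e x))))
  (hω : 0 < ω₂) (hl : 0 ≤ lam) (hβ : 0 ≤ β) (hT : 0 < T)

include hAdm hcorr hlap he hFI hω hl hβ hT in
/-- **The fixed-`(N, s)` apex bound.** With the `FeshbachIdentities` package (bilinearity of the Schur pairing),
a nonnegative kernel majorant `K` of the negative part of the bond memory `schur_s(j_b, j_{b'}) ≥ −K(|b − b'|)`, the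
tent `ξ`, its gradient `g` and current `J_ξ = Σ_b g_b j_b`: if `4Σ_{z<N} zK(z) + 16Σ_{z<N} K(z) ≤ B` then
`schur_s(J_ξ, J_ξ) ≤ schur_s(J, J) + B`. -/
theorem fixedN_apexBound (hN : 2 ≤ N) {s : ℝ} (hs : 0 ≤ s) (G : Matrix (Fin N) (Fin N) ℝ)
    (schur : (PhaseSpace N → ℝ) → (PhaseSpace N → ℝ) → ℝ)
    (hschur : ∀ f g, schur f g = lap s f g - ∑ u, ∑ v, lap s f (e u) * G⁻¹ u v * lap s (e v) g)
    (K : ℕ → ℝ) (hK : ∀ z, 0 ≤ K z)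
    (ξ : Fin N → ℝ) (hξ : ∀ x : Fin N, ξ x = ((min x.val (N - 1 - x.val) : ℕ) : ℝ))
    (g : Fin N → ℝ) (hg : ∀ b : Fin N, g b = ∑ j : Fin N, if j.val = b.val + 1 then ξ j - ξ b else 0)
    {Jξ J : PhaseSpace N → ℝ}
    (hJξ : Jξ = fun z => ∑ b, g b * (pinnedChain ω₂ lam β γ).bondCurrent N b z)
    (hJ : J = fun z => ∑ b, (pinnedChain ω₂ lam β γ).bondCurrent N b z)
    (hloc : ∀ (z : ℕ) (b b' : Fin N), b'.val = b.val + z →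
      -K z ≤ schur ((pinnedChain ω₂ lam β γ).bondCurrent N b) ((pinnedChain ω₂ lam β γ).bondCurrent N b') ∧
      -K z ≤ schur ((pinnedChain ω₂ lam β γ).bondCurrent N b') ((pinnedChain ω₂ lam β γ).bondCurrent N b))
    {B : ℝ} (hB : 4 * ∑ z ∈ Finset.range N, (z : ℝ) * K z + 16 * ∑ z ∈ Finset.range N, K z ≤ B) :
    schur Jξ Jξ ≤ schur J J + B := by
  set j : Fin N → PhaseSpace N → ℝ := (pinnedChain ω₂ lam β γ).bondCurrent N with hj
  have hJ1 : J = fun z => ∑ b, (fun _ : Fin N => (1 : ℝ)) b * j b z := by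
    rw [hJ]
    funext z
    simp only [one_mul]
  have e1 : schur Jξ Jξ = ∑ b, ∑ b', g b * g b' * schur (j b) (j b') := by
    rw [hJξ]
    exact stub_cutExpansion hAdm hcorr hlap he hFI hω hl hβ hT hs G schur hschur g g
  have e2 : schur J J = ∑ b, ∑ b', (fun _ : Fin N => (1 : ℝ)) b * (fun _ : Fin N => (1 : ℝ)) b' *
      schur (j b) (j b') := by
    rw [hJ1]
    exact stub_cutExpansion hAdm hcorr hlap he hFI hω hl hβ hT hs G schur hschur
      (fun _ => (1 : ℝ)) (fun _ => (1 : ℝ))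
  obtain ⟨hgg, hcount⟩ := stub_cutCount N hN K hK ξ hξ g hg
  have hpt : ∀ b b' : Fin N, g b * g b' * schur (j b) (j b') -
      (fun _ : Fin N => (1 : ℝ)) b * (fun _ : Fin N => (1 : ℝ)) b' * schur (j b) (j b') ≤
      (1 - g b * g b') * K (b.val - b'.val + (b'.val - b.val)) := by
    intro b b'
    have hneg : -K (b.val - b'.val + (b'.val - b.val)) ≤ schur (j b) (j b') := by
      rcases le_total b.val b'.val with h | h
      · have hz : b'.val = b.val + (b.val - b'.val + (b'.val - b.val)) := by omega
        exact (hloc _ b b' hz).1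
      · have hz : b.val = b'.val + (b.val - b'.val + (b'.val - b.val)) := by omega
        exact (hloc _ b' b hz).2
    have hc : 0 ≤ 1 - g b * g b' := by linarith [hgg b b']
    have hprod : 0 ≤ (1 - g b * g b') * (schur (j b) (j b') + K (b.val - b'.val + (b'.val - b.val))) :=
      mul_nonneg hc (by linarith)
    simp only [one_mul]
    nlinarith
  have hdiff : schur Jξ Jξ - schur J J ≤
      ∑ b, ∑ b', (1 - g b * g b') * K (b.val - b'.val + (b'.val - b.val)) := by
    rw [e1, e2, ← Finset.sum_sub_distrib]
    refine Finset.sum_le_sum fun b _ => ?_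
    rw [← Finset.sum_sub_distrib]
    exact Finset.sum_le_sum fun b' _ => hpt b b'
  linarith

end Package

/-- **Apex sub-extensivity from one-sided memory locality.** `FeshbachIdentities` (bilinearity of the Schur
pairing at fixed `N`, `s`) and the one-sided memory-locality stub imply the `ε`-form apex bound consumed by the
landed reductions `stub_robinReduction` / `stub_tentReduction`: `schur_s(J_ξ,J_ξ) − schur_s(J,J) =
−Σ_{b,b'}(1 − g_b g_{b'})𝔎_{bb'}(s) ≤ Σ(1 − g_b g_{b'})K(|b−b'|) ≤ 4Σ_{z<N} zK(z) + 16‖K‖₁ ≤ εN + C_A(ε)`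
(Kronecker's lemma). -/
theorem stub_localityReduction :
    Summit.AtomisticToContinuum.FouriersLaw.Theses.HonestZwanzig.FeshbachIdentities →
    (∀ ω₂ lam β γ : ℝ, 0 < ω₂ → 0 < lam → 0 < β → 0 < γ → ∀ T : ℝ, 0 < T →
      ∃ K : ℕ → ℝ, (∀ z, 0 ≤ K z) ∧ Summable K ∧ ∀ N : ℕ, 2 ≤ N →
      let P := Literature.MathematicalPhysics.KineticTheory.HeatConduction.pinnedChain ω₂ lam β γ;
      let X := Literature.MathematicalPhysics.KineticTheory.HeatConduction.PhaseSpace N;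
      let μ : MeasureTheory.Measure X := P.gibbsMeasure N T;
      let corr : (X → ℝ) → (X → ℝ) → ℝ → ℝ := fun f g t =>
        (∫ z, f z * (∫ y, g y ∂(P.transitionKernel N T T t.toNNReal z)) ∂μ) - (∫ z, f z ∂μ) * (∫ z, g z ∂μ);
      let lap : ℝ → (X → ℝ) → (X → ℝ) → ℝ := fun s f g =>
        ∫ t in Set.Ioi (0 : ℝ), Real.exp (-(s * t)) * corr f g t;
      let e : Fin N → X → ℝ := fun x z => z.2 x ^ 2 / 2 + P.U (z.1 x) +
        ∑ j : Fin N, ((if j.val = x.val + 1 then P.V (z.1 j - z.1 x) / 2 else 0) +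
          (if x.val = j.val + 1 then P.V (z.1 x - z.1 j) / 2 else 0));
      let G : ℝ → Matrix (Fin N) (Fin N) ℝ := fun s => Matrix.of fun x y => lap s (e x) (e y);
      let schur : ℝ → (X → ℝ) → (X → ℝ) → ℝ := fun s f g =>
        lap s f g - ∑ x : Fin N, ∑ y : Fin N, lap s f (e x) * (G s)⁻¹ x y * lap s (e y) g;
      ∃ s₀ : ℝ, 0 < s₀ ∧ ∀ s : ℝ, 0 < s → s < s₀ → ∀ (z : ℕ) (b b' : Fin N), b'.val = b.val + z →
        -K z ≤ schur s (P.bondCurrent N b) (P.bondCurrent N b') ∧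
          -K z ≤ schur s (P.bondCurrent N b') (P.bondCurrent N b)) →
    ∀ ω₂ lam β γ : ℝ, 0 < ω₂ → 0 < lam → 0 < β → 0 < γ → ∀ T : ℝ, 0 < T → ∀ ε : ℝ, 0 < ε → ∃ C_A : ℝ, ∀ N : ℕ, 2 ≤ N →
    let P := Literature.MathematicalPhysics.KineticTheory.HeatConduction.pinnedChain ω₂ lam β γ;
    let X := Literature.MathematicalPhysics.KineticTheory.HeatConduction.PhaseSpace N;
    let μ : MeasureTheory.Measure X := P.gibbsMeasure N T;
    let corr : (X → ℝ) → (X → ℝ) → ℝ → ℝ := fun f g t =>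
      (∫ z, f z * (∫ y, g y ∂(P.transitionKernel N T T t.toNNReal z)) ∂μ) - (∫ z, f z ∂μ) * (∫ z, g z ∂μ);
    let lap : ℝ → (X → ℝ) → (X → ℝ) → ℝ := fun s f g =>
      ∫ t in Set.Ioi (0 : ℝ), Real.exp (-(s * t)) * corr f g t;
    let e : Fin N → X → ℝ := fun x z => z.2 x ^ 2 / 2 + P.U (z.1 x) +
      ∑ j : Fin N, ((if j.val = x.val + 1 then P.V (z.1 j - z.1 x) / 2 else 0) +
        (if x.val = j.val + 1 then P.V (z.1 x - z.1 j) / 2 else 0));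
    let G : ℝ → Matrix (Fin N) (Fin N) ℝ := fun s => Matrix.of fun x y => lap s (e x) (e y);
    let schur : ℝ → (X → ℝ) → (X → ℝ) → ℝ := fun s f g =>
      lap s f g - ∑ x : Fin N, ∑ y : Fin N, lap s f (e x) * (G s)⁻¹ x y * lap s (e y) g;
    let J : X → ℝ := fun z => ∑ i : Fin N, P.bondCurrent N i z;
    let ξ : Fin N → ℝ := fun x => ((min x.val (N - 1 - x.val) : ℕ) : ℝ);
    let Jξ : X → ℝ := fun z =>
      ∑ b : Fin N, (∑ j : Fin N, if j.val = b.val + 1 then ξ j - ξ b else 0) * P.bondCurrent N b z;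
    ∃ s₀ : ℝ, 0 < s₀ ∧ ∀ s : ℝ, 0 < s → s < s₀ → schur s Jξ Jξ ≤ schur s J J + (ε * (N : ℝ) + C_A) := by
  intro hFI hL ω₂ lam β γ hω hl hβ hγ T hT ε hε
  obtain ⟨K, hK0, hKs, hLN⟩ := hL ω₂ lam β γ hω hl hβ hγ T hT
  obtain ⟨C₁, hC₁⟩ := stub_kronecker K hK0 hKs (ε / 4) (by positivity)
  refine ⟨4 * C₁ + 16 * ∑' z, K z, fun N hN => ?_⟩
  obtain ⟨-, hFI2, -, -⟩ := hFI ω₂ lam β γ hω hl hβ hγ T hT N hN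
  obtain ⟨s₀, hs₀, hloc⟩ := hLN N hN
  intro P X μ corr lap e G schur J ξ Jξ
  refine ⟨s₀, hs₀, fun s hs hs' => ?_⟩
  have htail : ∑ z ∈ Finset.range N, K z ≤ ∑' z, K z := hKs.sum_le_tsum (Finset.range N) (fun z _ => hK0 z)
  have hB : 4 * ∑ z ∈ Finset.range N, (z : ℝ) * K z + 16 * ∑ z ∈ Finset.range N, K z ≤
      ε * (N : ℝ) + (4 * C₁ + 16 * ∑' z, K z) := by
    have h := hC₁ N
    linarith
  exact fixedN_apexBound (ω₂ := ω₂) (lam := lam) (β := β) (γ := γ) (N := N) (T := T)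
    (cov := fun f g => (∫ z, f z * g z ∂μ) - (∫ z, f z ∂μ) * (∫ z, g z ∂μ))
    (fun f => Iff.rfl) (fun f g t => rfl) (fun s f g => rfl) (fun x z => rfl) hFI2 hω hl.le hβ.le hT hN hs.le
    (G s) (schur s) (fun f g => rfl) K hK0 ξ (fun x => rfl)
    (fun b => ∑ j : Fin N, if j.val = b.val + 1 then ξ j - ξ b else 0) (fun b => rfl) rfl rfl
    (hloc s hs hs') hB

end Summit.AtomisticToContinuum.FouriersLaw.Theorems.HonestZwanzig.PositiveMemory

end
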